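import Mathlib
import HarnessLib
import Summits.NavierStokesRegularity.NavierStokesRegularity.Theorems.UnthreadedDoorCellFluxDefs
import Summits.NavierStokesRegularity.NavierStokesRegularity.Theorems.UnthreadedDoorCellFluxClusterFluxNearCentreCap
import Summits.NavierStokesRegularity.NavierStokesRegularity.Theorems.UnthreadedDoorCellFluxClusterFluxLeVorticity

/-!
# Route `UnthreadedDoor`, crux `PoloidalLiouville` (stmt-NavierStokesRegularity-1222), WALL W1 — crux idea «cell-flux», Σ-3′ inputs:
# Theorems-side DEFS TWIN of the window-decay statements of `Cruxes/PoloidalLiouville/CellFluxSketch.lean` v1.2.12 (d25b9ed27086)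

Statement-only file (definitions + sorry-free kernel glue), companion of the Defs twin `UnthreadedDoorCellFluxDefs` (p692073) and of ARM A's
`UnthreadedDoorCellFluxClusterFluxNearCentreCap` (p718757, which typed Σ-0bR₁ `ClusterFluxNearCentreCap`).  It lands the NAMES the Σ-3′ re-run
(`Theorems/UnthreadedDoorCellFluxWindowDecayOffNullInt.lean`) is stated over, bodies VERBATIM from the sketch (namespace moved from
`Cruxes.PoloidalLiouville.CellFlux` to `Theorems.PoloidalLiouville.CellFlux`, so the sketch's §4 anti-drift guard can `rfl`-pin them):

* `OUViscosityIneqAt`, `HalfLineOUDecayOffNullClosed` — AE-2′, the off-null half-line OU comparison (LANDED p687414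
  `NetFlux.halfLineOU_decay_viscosity_offNull`; `halfLineOUDecayOffNullClosed_holds` below closes it by name);
* Σ-0b′ `ClusterFluxNearCentreLinked`, Σ-0bR₂ `ClusterFluxNearCentreLipschitz` and the kernel glue `clusterFluxNearCentreLinked_of`
  (Σ-0bR₁ + Σ-0bR₂ ⇒ Σ-0b′);
* Σ-3′ `ClusterFluxWindowDecayOffNullInt` and the kernel glue `clusterFluxWindowDecayOffNull_of_int` (Σ-3′ ⇒ Σ-3);
* NEW (ns-qj-p1 g8 typing note, bus 2026-08-29T14:31Z): **Σ-0e `ClusterFluxTimeLipschitz`** — the cluster analogue of the «null-time» input AE-3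
  `CumulativeFluxLipschitz`: local-in-time LIPSCHITZ control of the cluster flux of an admissible rule AT EVERY RADIUS (Σ-0bR₂ (iii) gives it only
  at radii `a < a₀ ≤ 1`).  It is the one input of AE-4′ that the v1.2.12 stub `Σ-2 → Σ-0a → Σ-0b′ → AE-2′ → Σ-3′` does not carry: AE-2′'s hypothesis
  «`U` Lipschitz in `s` on every `[a,b] × [0,R]`» integrates the flux up to the radius `ρ e^{−s/2}`, unbounded in `ρ`.

HONEST LABEL: nothing here is proved about Navier–Stokes; Σ-0b′, Σ-0bR₂, Σ-0e, Σ-3′ are OPEN statements of the cell-flux chain (custodian ns-idea-14);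
⟨1222⟩ `PoloidalLiouville`, W1 and NS regularity are OPEN — NOT proved.
-/

noncomputable section

set_option linter.dupNamespace false

open Set Function Filter Topology MeasureTheory
open scoped RealInnerProductSpace

namespace Summit.NavierStokesRegularity.NavierStokesRegularity.Theorems.PoloidalLiouville.CellFlux

open Summit.NavierStokesRegularity.NavierStokesRegularity.Theorems.PoloidalLiouville.NetFlux (E3 CurledLaw)
open Literature.Analysis Literature.Analysis.FluidPDE

/-! ### AE-2′ (copies of the null-time sketch's statements; the theorem is LANDED p687414) -/

/-- The cross-class OU viscosity inequality at the touching points allowed by `ok` (copy of `NullTime.OUViscosityIneqAt`, verbatim from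
`CellFluxSketch.lean` §P). -/
def OUViscosityIneqAt (U : ℝ → ℝ → ℝ) (s₁ C : ℝ) (ok : ℝ → Prop) : Prop :=
  ∀ (φ : ℝ → ℝ → ℝ) (φₛ : ℝ) (φ₁ φ₂ : ℝ → ℝ) (s₀ ρ₀ : ℝ), s₁ < s₀ → 0 < ρ₀ → ok s₀ →
    HasDerivAt (fun σ => φ σ ρ₀) φₛ s₀ →
    (∀ r, HasDerivAt (φ s₀) (φ₁ r) r) → (∀ r, HasDerivAt φ₁ (φ₂ r) r) →
    IsLocalMax (fun p : ℝ × ℝ => U p.1 p.2 - φ p.1 p.2) (s₀, ρ₀) →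
    φₛ ≤ φ₂ ρ₀ + (C - ρ₀ / 2) * φ₁ ρ₀

/-- AE-2′ (copy of `NullTime.HalfLineOUDecayOffNullClosed`, verbatim from `CellFluxSketch.lean` §P): half-line OU decay in the cubic growth class,
viscosity form, with the subsolution inequality only at touching times outside a closed null set `D`, for `U` continuous, locally Lipschitz in `s`. -/
def HalfLineOUDecayOffNullClosed : Prop :=
  ∀ C : ℝ, 0 ≤ C → ∃ lam > 0, ∃ A : ℝ, ∀ (U : ℝ → ℝ → ℝ) (s₁ c : ℝ) (D : Set ℝ), IsClosed D → volume D = 0 →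
    ContinuousOn (uncurry U) (Ici s₁ ×ˢ Ici 0) →
    (∀ s, s₁ ≤ s → U s 0 ≤ 0) →
    (∀ s, s₁ ≤ s → ∀ ρ, 0 ≤ ρ → U s ρ ≤ c * (1 + ρ) ^ 3) →
    0 ≤ c →
    (∀ a b R : ℝ, s₁ < a → a < b → 0 < R →
      ∃ L : NNReal, ∀ ρ ∈ Icc 0 R, LipschitzOnWith L (fun s => U s ρ) (Icc a b)) →
    OUViscosityIneqAt U s₁ C (fun s => s ∉ D) →
    ∀ s, s₁ ≤ s → ∀ ρ, 0 ≤ ρ → U s ρ ≤ A * c * (1 + ρ) ^ 3 * Real.exp (-lam * (s - s₁))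

/-- (kernel) AE-2′ CLOSED BY NAME: ARM A's `NetFlux.halfLineOU_decay_viscosity_offNull` (p687414). -/
theorem halfLineOUDecayOffNullClosed_holds : HalfLineOUDecayOffNullClosed :=
  Theorems.PoloidalLiouville.NetFlux.halfLineOU_decay_viscosity_offNull

/-! ### Σ-0b′ and its split (bodies verbatim from `CellFluxSketch.lean` v1.2.12 §2) -/

/-- **Σ-0b′ `ClusterFluxNearCentreLinked` (support, S/M; v1.2.7 — the re-typing of the refuted Σ-0b `ClusterFluxNearCentre`): near-centre control of
the cluster flux of an admissible rule FOR A LINKED SMOOTH FIELD.**  NF-6's binder block is prepended — the velocity field `v`, smooth on the window slab,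
and the link `curl (v t) = ∇(T t) × (· − x₀)` — together with a DENSE near-centre class-count bound (`≤ N₀` cells on a dense set of
`(t, a) ∈ [t₁,t₂] × (0,1)`).  Conclusion = NF-6's three conjuncts for `a ↦ clusterFlux (T t) a (𝒞 t a)`.  In the sketch it is the THEOREM
`clusterFluxNearCentreLinked_of` over the split Σ-0bR₁ (`ClusterFluxNearCentreCap`, LANDED p718757 modulo Σ-0a p717414) + Σ-0bR₂
(`ClusterFluxNearCentreLipschitz`, OPEN).  Body verbatim. -/
def ClusterFluxNearCentreLinked : Prop :=
  ∀ (v : ℝ → E3 → E3) (x₀ : E3) (T P : ℝ → E3 → ℝ) (V : ℝ → ℝ) (N₀ : ℕ) (t₀ t₁ t₂ : ℝ), t₀ < t₁ → t₁ ≤ t₂ → t₂ < 0 →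
    ContDiffOn ℝ (⊤ : ℕ∞) (uncurry v) (Ioo t₀ 0 ×ˢ (univ : Set E3)) →
    ContDiffOn ℝ (⊤ : ℕ∞) (uncurry T) (Ioo t₀ 0 ×ˢ ({x₀}ᶜ : Set E3)) →
    (∀ t ∈ Ioo t₀ 0, ∀ x, curl (v t) x = cross (gradient (T t) x) (x - x₀)) →
    Icc t₁ t₂ ×ˢ Ioo (0 : ℝ) 1 ⊆ closure {p : ℝ × ℝ | p.1 ∈ Ioo t₀ 0 ∧ 0 < p.2 ∧
        (cellSet (T p.1) x₀ p.2).Finite ∧ (cellSet (T p.1) x₀ p.2).ncard ≤ N₀} →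
    ∀ 𝒞 : ℝ → ℝ → Set (Set E3), AdmissibleRule x₀ T P V t₀ 𝒞 →
    ∃ κ : ℝ, 0 ≤ κ ∧ ∀ a₀ : ℝ, 0 < a₀ → a₀ ≤ 1 →
      (∀ t ∈ Icc t₁ t₂,
        (∀ a ∈ Ioo 0 a₀, clusterFlux (T t) a (𝒞 t a) ≤ κ * a ^ 2) ∧
        LipschitzOnWith (Real.toNNReal (κ * a₀)) (fun r => clusterFlux (T t) r (𝒞 t r)) (Ioo 0 a₀)) ∧
      (∀ t ∈ Icc t₁ t₂, ∀ t' ∈ Icc t₁ t₂, ∀ a ∈ Ioo 0 a₀,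
        |clusterFlux (T t) a (𝒞 t a) - clusterFlux (T t') a (𝒞 t' a)| ≤ κ * a ^ 2 * |t - t'|)

/-- **Σ-0bR₂ `ClusterFluxNearCentreLipschitz` (support, OPEN, M; v1.2.8 — conjuncts (ii)+(iii) of Σ-0b′ over the same binders): r- and t-LIPSCHITZ
control of the cluster flux near the centre.**  A genuine statement about ADMISSIBLE RULES (differences of the cluster flux compare class oscillations
over two different partitions); custodian's C0 note: sheet births are harmless (`T = φ² u` near a gauged sheet, newborn-cell osc `≲ (a − a_b)²`), the
M content is the envelope bound across re-grouping events between different sheet components.  Body verbatim. -/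
def ClusterFluxNearCentreLipschitz : Prop :=
  ∀ (v : ℝ → E3 → E3) (x₀ : E3) (T P : ℝ → E3 → ℝ) (V : ℝ → ℝ) (N₀ : ℕ) (t₀ t₁ t₂ : ℝ), t₀ < t₁ → t₁ ≤ t₂ → t₂ < 0 →
    ContDiffOn ℝ (⊤ : ℕ∞) (uncurry v) (Ioo t₀ 0 ×ˢ (univ : Set E3)) →
    ContDiffOn ℝ (⊤ : ℕ∞) (uncurry T) (Ioo t₀ 0 ×ˢ ({x₀}ᶜ : Set E3)) →
    (∀ t ∈ Ioo t₀ 0, ∀ x, curl (v t) x = cross (gradient (T t) x) (x - x₀)) →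
    Icc t₁ t₂ ×ˢ Ioo (0 : ℝ) 1 ⊆ closure {p : ℝ × ℝ | p.1 ∈ Ioo t₀ 0 ∧ 0 < p.2 ∧
        (cellSet (T p.1) x₀ p.2).Finite ∧ (cellSet (T p.1) x₀ p.2).ncard ≤ N₀} →
    ∀ 𝒞 : ℝ → ℝ → Set (Set E3), AdmissibleRule x₀ T P V t₀ 𝒞 →
    ∃ κ : ℝ, 0 ≤ κ ∧ ∀ a₀ : ℝ, 0 < a₀ → a₀ ≤ 1 →
      (∀ t ∈ Icc t₁ t₂,
        LipschitzOnWith (Real.toNNReal (κ * a₀)) (fun r => clusterFlux (T t) r (𝒞 t r)) (Ioo 0 a₀)) ∧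
      (∀ t ∈ Icc t₁ t₂, ∀ t' ∈ Icc t₁ t₂, ∀ a ∈ Ioo 0 a₀,
        |clusterFlux (T t) a (𝒞 t a) - clusterFlux (T t') a (𝒞 t' a)| ≤ κ * a ^ 2 * |t - t'|)

/-- (kernel, verbatim from the sketch) **Σ-0bR₁ + Σ-0bR₂ ⇒ Σ-0b′** (κ := max κ₁ κ₂). -/
theorem clusterFluxNearCentreLinked_of (h₁ : ClusterFluxNearCentreCap) (h₂ : ClusterFluxNearCentreLipschitz) :
    ClusterFluxNearCentreLinked := by
  intro v x₀ T P V N₀ t₀ t₁ t₂ h01 h12 h20 hv hT hlink hcount 𝒞 h𝒞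
  obtain ⟨κ₁, hκ₁, H₁⟩ := h₁ v x₀ T P V N₀ t₀ t₁ t₂ h01 h12 h20 hv hT hlink hcount 𝒞 h𝒞
  obtain ⟨κ₂, hκ₂, H₂⟩ := h₂ v x₀ T P V N₀ t₀ t₁ t₂ h01 h12 h20 hv hT hlink hcount 𝒞 h𝒞
  refine ⟨max κ₁ κ₂, le_max_of_le_left hκ₁, fun a₀ ha₀ ha₁ => ?_⟩
  obtain ⟨H₂a, H₂b⟩ := H₂ a₀ ha₀ ha₁
  refine ⟨fun t ht => ⟨fun a ha => ?_, ?_⟩, fun t ht t' ht' a ha => ?_⟩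
  · exact (H₁ t ht a ⟨ha.1, lt_of_lt_of_le ha.2 ha₁⟩).trans
      (mul_le_mul_of_nonneg_right (le_max_left _ _) (sq_nonneg a))
  · exact (H₂a t ht).weaken
      (Real.toNNReal_le_toNNReal (mul_le_mul_of_nonneg_right (le_max_right _ _) ha₀.le))
  · exact (H₂b t ht t' ht' a ha).trans
      (mul_le_mul_of_nonneg_right (mul_le_mul_of_nonneg_right (le_max_right _ _) (sq_nonneg a)) (abs_nonneg _))

/-- (kernel) **Σ-0b′ modulo Σ-0bR₂ only** — Σ-0bR₁ is ARM A's `clusterFluxNearCentreCap_of` (p718757) fed with ns-qj-p1's Σ-0a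
`clusterFluxLeVorticity` (p717414). -/
theorem clusterFluxNearCentreLinked_of_lipschitz (h₂ : ClusterFluxNearCentreLipschitz) : ClusterFluxNearCentreLinked :=
  clusterFluxNearCentreLinked_of (clusterFluxNearCentreCap_of clusterFluxLeVorticity) h₂

/-! ### Σ-0e (NEW, ns-qj-p1 g8): time-Lipschitz control of the cluster flux at every radius -/

/-- **Σ-0e `ClusterFluxTimeLipschitz` (support, NEW — the cluster analogue of the «null-time» input AE-3 `CumulativeFluxLipschitz`; OPEN, of the same
nature as Σ-0bR₂ (iii)).**  Binders = Σ-0bR₂'s (NF-6's block: `v` smooth on the window slab, `T` smooth off the centre, the link), except that the dense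
class-count bound is asked on `[t₁,t₂] × (0,∞)` (the consumer Σ-3′ has it from `cellPred N₀ D` with `D`, `B_t` closed null); conclusion: on every compact
time interval `[t₁,t₂] ⊂ ]t₀,0[` and every bounded range of radii `(0,R)` the cluster flux of an admissible rule is LIPSCHITZ IN TIME, uniformly in the
radius: `|F(t,a) − F(t′,a)| ≤ L |t − t′|`.  WHY IT IS NEEDED: the off-null OU comparison AE-2′ (`HalfLineOUDecayOffNullClosed`) asks for the self-similar
cumulative flux `U(s,ρ) = ∫₀^{ρe^{−s/2}} F(−e^{−s}, r) dr` to be Lipschitz in `s` on every `[a,b] × [0,R]` — at the exceptional times too (that is what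
pushes the barrier maximiser off the null set; without it AE-2 was false, Cantor creep) — and `ρ e^{−s/2}` is unbounded, so Σ-0b′ (iii) (radii `< 1`) does
not suffice.  WHY IT MIGHT HOLD: for the unclustered net flux it is free (`T` smooth in `t`: AE-3, p686120); for the cluster flux it is Σ-0bR₂ (iii) without
the weight `a²`, and Σ-0bR₂ (iii) applied to every parabolic rescaling `v_μ(t,x) = μ v(μ²t, x₀ + μ(x − x₀))` (under which `F_μ(t,ρ) = μ F(μ²t, μρ)` and
all binders are covariant) gives it at all radii — the covariance of `sheetTrace`/`cellSet`/`AdmissibleRule` under similarities is the (M-Lean) content of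
that reduction.  WHY IT MIGHT FAIL: as Σ-0bR₂ — one-sided `√`-rates of the flux at rule events are not excluded by admissibility as typed. -/
def ClusterFluxTimeLipschitz : Prop :=
  ∀ (v : ℝ → E3 → E3) (x₀ : E3) (T P : ℝ → E3 → ℝ) (V : ℝ → ℝ) (N₀ : ℕ) (t₀ t₁ t₂ : ℝ), t₀ < t₁ → t₁ ≤ t₂ → t₂ < 0 →
    ContDiffOn ℝ (⊤ : ℕ∞) (uncurry v) (Ioo t₀ 0 ×ˢ (univ : Set E3)) →
    ContDiffOn ℝ (⊤ : ℕ∞) (uncurry T) (Ioo t₀ 0 ×ˢ ({x₀}ᶜ : Set E3)) →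
    (∀ t ∈ Ioo t₀ 0, ∀ x, curl (v t) x = cross (gradient (T t) x) (x - x₀)) →
    Icc t₁ t₂ ×ˢ Ioi (0 : ℝ) ⊆ closure {p : ℝ × ℝ | p.1 ∈ Ioo t₀ 0 ∧ 0 < p.2 ∧
        (cellSet (T p.1) x₀ p.2).Finite ∧ (cellSet (T p.1) x₀ p.2).ncard ≤ N₀} →
    ∀ 𝒞 : ℝ → ℝ → Set (Set E3), AdmissibleRule x₀ T P V t₀ 𝒞 →
    ∀ R : ℝ, 0 < R → ∃ L : ℝ, 0 ≤ L ∧ ∀ t ∈ Icc t₁ t₂, ∀ t' ∈ Icc t₁ t₂, ∀ a ∈ Ioo 0 R,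
      |clusterFlux (T t) a (𝒞 t a) - clusterFlux (T t') a (𝒞 t' a)| ≤ L * |t - t'|

/-! ### Σ-3′ (body verbatim from `CellFluxSketch.lean` v1.2.12 §2) -/

/-- **Σ-3′ `ClusterFluxWindowDecayOffNullInt` (v1.2.10; S⁺; supersedes Σ-3 `ClusterFluxWindowDecayOffNull` of the Defs twin as the chain's decay
statement).**  Σ-3's body VERBATIM with ONE conjunct `IntegrableOn (fun r => clusterFlux (T t) r (𝒞 t r)) (Ioo 0 R) ∧` prepended to the conclusion
(the hypothesis `h3` of the Σ-4 CORE `cellTameAnalytic_of_decayIntegrable`, p723451): window decay of the cumulative cluster flux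
`∫₀ᴿ F(t) ≤ A N₀ C₁ (1 + R/√(−t))³ (t/t₁)^λ` on the stratum `cellPred N₀ D`, `D` closed null, for every admissible rule.  Body verbatim. -/
def ClusterFluxWindowDecayOffNullInt : Prop :=
  ∀ (N₀ : ℕ) (D : Set ℝ), IsClosed D → volume D = 0 → ∀ C : ℝ, 0 ≤ C → ∃ lam > (0 : ℝ), ∃ A : ℝ,
    ∀ (v : ℝ → E3 → E3) (x₀ : E3) (T P : ℝ → E3 → ℝ) (C₁ t₀ : ℝ), t₀ < 0 →
    ContDiffOn ℝ (⊤ : ℕ∞) (uncurry v) (Ioo t₀ 0 ×ˢ univ) →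
    ContDiffOn ℝ (⊤ : ℕ∞) (uncurry T) (Ioo t₀ 0 ×ˢ ({x₀}ᶜ : Set E3)) →
    (∀ t ∈ Ioo t₀ 0, ContDiffOn ℝ 1 (P t) ({x₀}ᶜ : Set E3)) →
    (∀ t ∈ Ioo t₀ 0, ∀ x, ‖v t x‖ ≤ C / Real.sqrt (-t)) →
    (∀ t ∈ Ioo t₀ 0, ∀ x, ‖curl (v t) x‖ ≤ C₁ / (-t)) →
    (∀ t ∈ Ioo t₀ 0, ∀ x, x ≠ x₀ →
        cross (gradient (P t) x - (inner ℝ (v t x) (x - x₀)) • gradient (T t) x) (x - x₀) = 0) →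
    (∀ t ∈ Ioo t₀ 0, ∀ x, curl (v t) x = cross (gradient (T t) x) (x - x₀)) →
    CurledLaw v x₀ T (Ioo t₀ 0) →
    (∀ t ∈ Ioo t₀ 0, cellPred N₀ D v x₀ T t) →
    ∀ 𝒞 : ℝ → ℝ → Set (Set E3), AdmissibleRule x₀ T P (fun t => C / Real.sqrt (-t)) t₀ 𝒞 →
    ∀ t₁ t R : ℝ, t₀ < t₁ → t₁ ≤ t → t < 0 → 0 < R →
      IntegrableOn (fun r => clusterFlux (T t) r (𝒞 t r)) (Ioo 0 R) ∧
      ∫ r in Ioo 0 R, clusterFlux (T t) r (𝒞 t r)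
        ≤ A * (N₀ : ℝ) * C₁ * (1 + R / Real.sqrt (-t)) ^ 3 * (t / t₁) ^ lam

/-- (kernel, verbatim from the sketch) Σ-3′ ⇒ Σ-3 (`ClusterFluxWindowDecayOffNull` of the Defs twin): drop the integrability conjunct. -/
theorem clusterFluxWindowDecayOffNull_of_int (h : ClusterFluxWindowDecayOffNullInt) : ClusterFluxWindowDecayOffNull := by
  intro N₀ D hD hD0 C hC
  obtain ⟨lam, hlam, A, hA⟩ := h N₀ D hD hD0 C hC
  refine ⟨lam, hlam, A, ?_⟩
  intro v x₀ T P C₁ t₀ ht₀ hv hT hP hvb hωb hhead hlink hlaw hcell 𝒞 h𝒞 t₁ t R h₁ h₂ h₃ hR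
  exact (hA v x₀ T P C₁ t₀ ht₀ hv hT hP hvb hωb hhead hlink hlaw hcell 𝒞 h𝒞 t₁ t R h₁ h₂ h₃ hR).2

end Summit.NavierStokesRegularity.NavierStokesRegularity.Theorems.PoloidalLiouville.CellFlux

end
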